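import Summits.AtomisticToContinuum.HydrodynamicLimit.Theorems.CollisionIsometryCLTMacroClosureDefs
import Summits.AtomisticToContinuum.HydrodynamicLimit.Theorems.ImplosionDichotomyHsEosLowDensity
import Summits.AtomisticToContinuum.HydrodynamicLimit.Theorems.CollisionIsometryCLTHsFreeEnergyConvexBasic
import Literature.MathematicalPhysics.KineticTheory.HardSphereEulerLocalTheoryProofs

/-!
# Stub `stub_thermo` of the line `IdeatorTwoGen1Sketch` (crux `MacroClosure`, stmt-14870) —
# part 1: the equation of state in the dilute chamber and the smoothness clause

Support file (`--supports stmt-AtomisticToContinuum-14870`) for the registered stub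
`Barycentric.stub_thermo : ∃ η₃, 0 < η₃ ∧ ThermoChamber η₃` of the skeleton
`Cruxes/MacroClosure/Lines/IdeatorTwoGen1Sketch.lean`.

From the PROVED support item `ImplosionDichotomy.HsEosLowDensity` (stmt-0768,
`hsEosLowDensity_proof`: `f_ex = hsExcessFreeEnergy` agrees on `[0, η₀)` with a function `F`
real-analytic on `(−η₀, η₀)`, `F 0 = 0`, `F′(0) = 2π/3`) we derive the elementary thermodynamics of
the dilute chamber `chamber σ η = {0 < ρ, ρσ³ < η, |m|² < 2ρE}`, `η ≤ η₀`:

* (`f_ex ≥ 0` everywhere is the tree lemma `HsFreeEnergyConvex.hsExcessFreeEnergy_nonneg`,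
  imported here for the downstream coercivity estimate);
* `isOpen_chamber`, `stateOf_mem_chamber`, `stateOf_eta` (every physical state is
  `stateOf ρ u θ` of its primitive variables), `stateTemp_stateOf`, `hsEntropy_stateOf`;
* clause 1 of `ThermoChamber`: `contDiffOn_hsEntropy`, `contDiffOn_eulerFlux` — the entropy
  `η_σ` and the hs-Euler fluxes are `C^∞` on the chamber (composition of `log`, rational functions
  and the analytic `F`, resp. the jointly smooth pressure law `contDiffOn_hsPressure`).
-/

noncomputable section

open MeasureTheory Filter Set Topology InformationTheory
open scoped ENNReal ContDiff

namespace Summit.AtomisticToContinuum.HydrodynamicLimit.Theorems.MacroClosureLine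

open Literature.MathematicalPhysics.KineticTheory Literature.Analysis.FluidPDE
open Literature.Analysis.FunctionSpaces

namespace Barycentric

/-! ## The equation of state at small packing -/

/-- The data of `HsEosLowDensity` (proved, stmt-0768): a radius `η₀ > 0` and a function `F`
analytic on `(−η₀, η₀)` with `f_ex = F` on `[0, η₀)`, `F 0 = 0`, `F′ 0 = 2π/3`. -/
theorem eos_data : ∃ η₀ : ℝ, 0 < η₀ ∧ ∃ F : ℝ → ℝ, AnalyticOnNhd ℝ F (Ioo (-η₀) η₀) ∧
    EqOn hsExcessFreeEnergy F (Ico 0 η₀) ∧ F 0 = 0 ∧ deriv F 0 = 2 * Real.pi / 3 := by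
  obtain ⟨η₀, h0, F, hFa, hF, hF0, hF1, -⟩ := hsEosLowDensity_proof
  exact ⟨η₀, h0, F, hFa, hF, hF0, hF1⟩

variable {η₀ : ℝ} {F : ℝ → ℝ}

/-- On `(0, η₀)` the excess free energy has the derivative `F′`. -/
theorem hasDerivAt_hsExcessFreeEnergy (hFa : AnalyticOnNhd ℝ F (Ioo (-η₀) η₀))
    (hF : EqOn hsExcessFreeEnergy F (Ico 0 η₀)) {x : ℝ} (hx : x ∈ Ioo 0 η₀) :
    HasDerivAt hsExcessFreeEnergy (deriv hsExcessFreeEnergy x) x := by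
  have hmem : x ∈ Ioo (-η₀) η₀ := ⟨by linarith [hx.1, hx.2], hx.2⟩
  have hd : HasDerivAt F (deriv F x) x := (hFa x hmem).differentiableAt.hasDerivAt
  rw [deriv_hsExcessFreeEnergy_eq hF hx]
  exact hd.congr_of_eventuallyEq (hsExcessFreeEnergy_eventuallyEq hF hx)

/-- On `(0, η₀)` the derivative `f_ex′` (`= F′`) has the derivative `F″`. -/
theorem hasDerivAt_deriv_hsExcessFreeEnergy (hFa : AnalyticOnNhd ℝ F (Ioo (-η₀) η₀))
    (hF : EqOn hsExcessFreeEnergy F (Ico 0 η₀)) {x : ℝ} (hx : x ∈ Ioo 0 η₀) :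
    HasDerivAt (deriv hsExcessFreeEnergy) (deriv (deriv F) x) x := by
  have hmem : x ∈ Ioo (-η₀) η₀ := ⟨by linarith [hx.1, hx.2], hx.2⟩
  have hd : HasDerivAt (deriv F) (deriv (deriv F) x) x :=
    (hFa.deriv x hmem).differentiableAt.hasDerivAt
  refine hd.congr_of_eventuallyEq ?_
  filter_upwards [isOpen_Ioo.mem_nhds hx] with y hy
  exact deriv_hsExcessFreeEnergy_eq hF hy

/-- `f_ex` is `C^∞` on `(0, η₀)`. -/
theorem contDiffOn_hsExcessFreeEnergy (hFa : AnalyticOnNhd ℝ F (Ioo (-η₀) η₀))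
    (hF : EqOn hsExcessFreeEnergy F (Ico 0 η₀)) :
    ContDiffOn ℝ ∞ hsExcessFreeEnergy (Ioo 0 η₀) := by
  have h : ContDiffOn ℝ ∞ F (Ioo 0 η₀) :=
    (hFa.contDiffOn_of_completeSpace).mono fun x hx => ⟨by linarith [hx.1, hx.2], hx.2⟩
  exact h.congr fun x hx => hF (Ioo_subset_Ico_self hx)

/-- `f_ex′` is `C^∞` on `(0, η₀)`. -/
theorem contDiffOn_deriv_hsExcessFreeEnergy (hFa : AnalyticOnNhd ℝ F (Ioo (-η₀) η₀))
    (hF : EqOn hsExcessFreeEnergy F (Ico 0 η₀)) :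
    ContDiffOn ℝ ∞ (deriv hsExcessFreeEnergy) (Ioo 0 η₀) := by
  have h : ContDiffOn ℝ ∞ (deriv F) (Ioo 0 η₀) :=
    (hFa.deriv.contDiffOn_of_completeSpace).mono fun x hx => ⟨by linarith [hx.1, hx.2], hx.2⟩
  exact h.congr fun x hx => deriv_hsExcessFreeEnergy_eq hF hx

/-! ## States, primitive variables and the chamber -/

/-- The entropy in terms of the temperature functional (definitional unfolding). -/
theorem hsEntropy_eq (σ : ℝ) (U : State) : hsEntropy σ U =
    -(U.1 * (3 / 2 * Real.log (stateTemp U) - Real.log U.1 - hsExcessFreeEnergy (U.1 * σ ^ 3))) :=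
  rfl

/-- Components of `stateOf`. -/
@[simp] theorem stateOf_fst (ρ : ℝ) (u : V3) (θ : ℝ) : (stateOf ρ u θ).1 = ρ := rfl

/-- Components of `stateOf`. -/
@[simp] theorem stateOf_snd_fst (ρ : ℝ) (u : V3) (θ : ℝ) : (stateOf ρ u θ).2.1 = ρ • u := rfl

/-- Components of `stateOf`. -/
@[simp] theorem stateOf_snd_snd (ρ : ℝ) (u : V3) (θ : ℝ) :
    (stateOf ρ u θ).2.2 = ρ * (‖u‖ ^ 2 / 2 + 3 / 2 * θ) := rfl

/-- The temperature of `stateOf ρ u θ` is `θ` (`ρ ≠ 0`). -/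
theorem stateTemp_stateOf {ρ : ℝ} (hρ : ρ ≠ 0) (u : V3) (θ : ℝ) :
    stateTemp (stateOf ρ u θ) = θ := by
  simp only [stateTemp, stateOf_fst, stateOf_snd_fst, stateOf_snd_snd, norm_smul,
    Real.norm_eq_abs, mul_pow, sq_abs]
  field_simp
  ring

/-- The entropy of `stateOf ρ u θ`: `η_σ = ρ log ρ − (3/2)ρ log θ + ρ f_ex(ρσ³)` (`ρ ≠ 0`). -/
theorem hsEntropy_stateOf (σ : ℝ) {ρ : ℝ} (hρ : ρ ≠ 0) (u : V3) (θ : ℝ) :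
    hsEntropy σ (stateOf ρ u θ) =
      ρ * Real.log ρ - 3 / 2 * ρ * Real.log θ + ρ * hsExcessFreeEnergy (ρ * σ ^ 3) := by
  rw [hsEntropy_eq, stateTemp_stateOf hρ, stateOf_fst]
  ring

/-- A state with `ρ ≠ 0` is `stateOf` of its primitive variables `(ρ, m/ρ, θ(U))`. -/
theorem stateOf_eta {U : State} (hU : U.1 ≠ 0) :
    stateOf U.1 (U.1⁻¹ • U.2.1) (stateTemp U) = U := by
  ext
  · rfl
  · simp [stateOf, smul_smul, mul_inv_cancel₀ hU]
  · simp only [stateOf_snd_snd, stateTemp, norm_smul, Real.norm_eq_abs, mul_pow, sq_abs, abs_inv,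
      inv_pow]
    field_simp
    ring

/-- Membership in the chamber, unfolded. -/
theorem mem_chamber_iff {σ η : ℝ} {U : State} :
    U ∈ chamber σ η ↔ 0 < U.1 ∧ U.1 * σ ^ 3 < η ∧ ‖U.2.1‖ ^ 2 < 2 * U.1 * U.2.2 :=
  Iff.rfl

/-- The chamber is open. -/
theorem isOpen_chamber (σ η : ℝ) : IsOpen (chamber σ η) := by
  have h1 : Continuous fun U : State => U.1 := continuous_fst
  have h2 : Continuous fun U : State => U.2.1 := continuous_fst.comp continuous_snd
  have h3 : Continuous fun U : State => U.2.2 := continuous_snd.comp continuous_snd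
  have h : chamber σ η = ({U : State | 0 < U.1} ∩ {U : State | U.1 * σ ^ 3 < η}) ∩
      {U : State | ‖U.2.1‖ ^ 2 < 2 * U.1 * U.2.2} := by
    ext U
    simp [mem_chamber_iff, and_assoc]
  rw [h]
  exact ((isOpen_lt continuous_const h1).inter (isOpen_lt (h1.mul continuous_const)
    continuous_const)).inter (isOpen_lt ((h2.norm).pow 2) ((continuous_const.mul h1).mul h3))

/-- On the chamber the temperature is positive. -/
theorem stateTemp_pos_of_mem {σ η : ℝ} {U : State} (hU : U ∈ chamber σ η) : 0 < stateTemp U := by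
  obtain ⟨h1, -, h3⟩ := hU
  unfold stateTemp
  have h : ‖U.2.1‖ ^ 2 / (2 * U.1 ^ 2) < U.2.2 / U.1 := by
    rw [div_lt_div_iff₀ (by positivity) h1]
    nlinarith
  linarith

/-- On the chamber the packing fraction lies in `(0, η)`. -/
theorem packing_mem_of_mem {σ η : ℝ} (hσ : 0 < σ) {U : State} (hU : U ∈ chamber σ η) :
    U.1 * σ ^ 3 ∈ Ioo 0 η :=
  ⟨mul_pos hU.1 (by positivity), hU.2.1⟩

/-- `stateOf ρ u θ` with `ρ, θ > 0` and `ρσ³ < η` lies in the chamber. -/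
theorem stateOf_mem_chamber {σ η ρ θ : ℝ} (u : V3) (hρ : 0 < ρ) (hθ : 0 < θ) (hx : ρ * σ ^ 3 < η) :
    stateOf ρ u θ ∈ chamber σ η := by
  refine ⟨hρ, hx, ?_⟩
  simp only [stateOf_fst, stateOf_snd_fst, stateOf_snd_snd, norm_smul, Real.norm_eq_abs, mul_pow,
    sq_abs]
  nlinarith [sq_nonneg ‖u‖, mul_pos (mul_pos hρ hρ) hθ]

/-- A point of the chamber in primitive variables: `U = stateOf ρ u θ` with `ρ = U.1 > 0`,
`θ = stateTemp U > 0`, `ρσ³ < η`. -/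
theorem exists_stateOf_of_mem {σ η : ℝ} {U : State} (hU : U ∈ chamber σ η) :
    ∃ ρ : ℝ, ∃ u : V3, ∃ θ : ℝ, 0 < ρ ∧ 0 < θ ∧ ρ * σ ^ 3 < η ∧ U = stateOf ρ u θ :=
  ⟨U.1, U.1⁻¹ • U.2.1, stateTemp U, hU.1, stateTemp_pos_of_mem hU, hU.2.1,
    (stateOf_eta hU.1.ne').symm⟩

/-! ## Clause 1: smoothness of the entropy and of the fluxes on the chamber -/

/-- The temperature functional is smooth off the vacuum. -/
theorem contDiffOn_stateTemp : ContDiffOn ℝ ∞ stateTemp {U : State | U.1 ≠ 0} := by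
  have h1 : ContDiff ℝ ∞ fun U : State => U.1 := contDiff_fst
  have h2 : ContDiff ℝ ∞ fun U : State => U.2.1 := contDiff_fst.comp contDiff_snd
  have h3 : ContDiff ℝ ∞ fun U : State => U.2.2 := contDiff_snd.comp contDiff_snd
  unfold stateTemp
  refine contDiffOn_const.mul ((h3.contDiffOn.div h1.contDiffOn fun U hU => hU).sub
    ((h2.contDiffOn.norm_sq ℝ).div (contDiffOn_const.mul (h1.contDiffOn.pow 2)) fun U hU => ?_))
  exact mul_ne_zero two_ne_zero (pow_ne_zero 2 hU)

/-- **Clause 1a.** The entropy `η_σ` is `C^∞` on the chamber `chamber σ η`, `η ≤ η₀`, `σ > 0`. -/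
theorem contDiffOn_hsEntropy (hFa : AnalyticOnNhd ℝ F (Ioo (-η₀) η₀))
    (hF : EqOn hsExcessFreeEnergy F (Ico 0 η₀)) {σ η : ℝ} (hσ : 0 < σ) (hη : η ≤ η₀) :
    ContDiffOn ℝ ∞ (hsEntropy σ) (chamber σ η) := by
  have h1 : ContDiff ℝ ∞ fun U : State => U.1 := contDiff_fst
  have hT : ContDiffOn ℝ ∞ stateTemp (chamber σ η) :=
    contDiffOn_stateTemp.mono fun U hU => hU.1.ne'
  have hlog1 : ContDiffOn ℝ ∞ (fun U : State => Real.log (stateTemp U)) (chamber σ η) :=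
    hT.log fun U hU => (stateTemp_pos_of_mem hU).ne'
  have hlog2 : ContDiffOn ℝ ∞ (fun U : State => Real.log U.1) (chamber σ η) :=
    h1.contDiffOn.log fun U hU => hU.1.ne'
  have hmaps : MapsTo (fun U : State => U.1 * σ ^ 3) (chamber σ η) (Ioo 0 η₀) := fun U hU =>
    ⟨(packing_mem_of_mem hσ hU).1, lt_of_lt_of_le hU.2.1 hη⟩
  have hf : ContDiffOn ℝ ∞ (fun U : State => hsExcessFreeEnergy (U.1 * σ ^ 3)) (chamber σ η) :=
    (contDiffOn_hsExcessFreeEnergy hFa hF).comp (h1.mul contDiff_const).contDiffOn hmaps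
  have h : ContDiffOn ℝ ∞ (fun U : State => -(U.1 * (3 / 2 * Real.log (stateTemp U) -
      Real.log U.1 - hsExcessFreeEnergy (U.1 * σ ^ 3)))) (chamber σ η) :=
    (h1.contDiffOn.mul (((contDiffOn_const.mul hlog1).sub hlog2).sub hf)).neg
  exact h.congr fun U _ => hsEntropy_eq σ U

/-- The pressure field `U ↦ p = hsPressure σ ρ θ(U)` is `C^∞` on the chamber, `η ≤ η₀`,
`σ > 0`. -/
theorem contDiffOn_pressure (hFa : AnalyticOnNhd ℝ F (Ioo (-η₀) η₀))
    (hF : EqOn hsExcessFreeEnergy F (Ico 0 η₀)) {σ η : ℝ} (hσ : 0 < σ) (hη : η ≤ η₀) :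
    ContDiffOn ℝ ∞ (fun U : State => hsPressure σ U.1 (stateTemp U)) (chamber σ η) := by
  have h1 : ContDiff ℝ ∞ fun U : State => U.1 := contDiff_fst
  have hT : ContDiffOn ℝ ∞ stateTemp (chamber σ η) :=
    contDiffOn_stateTemp.mono fun U hU => hU.1.ne'
  have hpair : ContDiffOn ℝ ∞ (fun U : State => (U.1, stateTemp U)) (chamber σ η) :=
    h1.contDiffOn.prodMk hT
  have hmaps : MapsTo (fun U : State => (U.1, stateTemp U)) (chamber σ η)
      {q : ℝ × ℝ | q.1 * σ ^ 3 ∈ Ioo 0 η₀} := fun U hU =>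
    ⟨(packing_mem_of_mem hσ hU).1, lt_of_lt_of_le hU.2.1 hη⟩
  exact (contDiffOn_hsPressure hFa hF σ).comp hpair hmaps

/-- **Clause 1b.** Each hs-Euler flux `F_j` is `C^∞` on the chamber `chamber σ η`, `η ≤ η₀`,
`σ > 0`. -/
theorem contDiffOn_eulerFlux (hFa : AnalyticOnNhd ℝ F (Ioo (-η₀) η₀))
    (hF : EqOn hsExcessFreeEnergy F (Ico 0 η₀)) {σ η : ℝ} (hσ : 0 < σ) (hη : η ≤ η₀) (j : Fin 3) :
    ContDiffOn ℝ ∞ (eulerFlux σ j) (chamber σ η) := by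
  have h1 : ContDiff ℝ ∞ fun U : State => U.1 := contDiff_fst
  have h2 : ContDiff ℝ ∞ fun U : State => U.2.1 := contDiff_fst.comp contDiff_snd
  have h3 : ContDiff ℝ ∞ fun U : State => U.2.2 := contDiff_snd.comp contDiff_snd
  have hj : ContDiff ℝ ∞ fun U : State => U.2.1 j :=
    (EuclideanSpace.proj j : V3 →L[ℝ] ℝ).contDiff.comp h2
  have hp := contDiffOn_pressure hFa hF hσ hη
  have hne : ∀ U ∈ chamber σ η, (fun U : State => U.1) U ≠ 0 := fun U hU => hU.1.ne'
  have hA : ContDiffOn ℝ ∞ (fun U : State => U.2.1 j) (chamber σ η) := hj.contDiffOn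
  have hB : ContDiffOn ℝ ∞ (fun U : State => (U.2.1 j / U.1) • U.2.1 +
      hsPressure σ U.1 (stateTemp U) • EuclideanSpace.single j (1 : ℝ)) (chamber σ η) :=
    ((hj.contDiffOn.div h1.contDiffOn hne).smul h2.contDiffOn).add (hp.smul contDiffOn_const)
  have hC : ContDiffOn ℝ ∞ (fun U : State =>
      (U.2.2 + hsPressure σ U.1 (stateTemp U)) * U.2.1 j / U.1) (chamber σ η) :=
    ((h3.contDiffOn.add hp).mul hj.contDiffOn).div h1.contDiffOn hne
  exact hA.prodMk (hB.prodMk hC)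

/-- **Clause 1 of `ThermoChamber η`** for every `η ≤ η₀`. -/
theorem thermo_clause1 (hFa : AnalyticOnNhd ℝ F (Ioo (-η₀) η₀))
    (hF : EqOn hsExcessFreeEnergy F (Ico 0 η₀)) {σ η : ℝ} (hσ : 0 < σ) (hη : η ≤ η₀) :
    ContDiffOn ℝ ∞ (hsEntropy σ) (chamber σ η) ∧ ∀ j, ContDiffOn ℝ ∞ (eulerFlux σ j) (chamber σ η) :=
  ⟨contDiffOn_hsEntropy hFa hF hσ hη, fun j => contDiffOn_eulerFlux hFa hF hσ hη j⟩

/-- **Registered sub-goal `stub_thermo_clause1` of `stub_thermo`**: clause 1 of `ThermoChamber η`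
for every `η ≤ η₀` of an `HsEosLowDensity` witness `(η₀, F)`. -/
theorem stub_thermo_clause1 : ∀ (η₀ : ℝ) (F : ℝ → ℝ), AnalyticOnNhd ℝ F (Ioo (-η₀) η₀) →
    EqOn hsExcessFreeEnergy F (Ico 0 η₀) → ∀ σ η : ℝ, 0 < σ → η ≤ η₀ →
    ContDiffOn ℝ ∞ (hsEntropy σ) (chamber σ η) ∧ ∀ j, ContDiffOn ℝ ∞ (eulerFlux σ j) (chamber σ η) :=
  fun _ _ hFa hF _ _ hσ hη => thermo_clause1 hFa hF hσ hη

/-- Differentiability of the entropy at a point of the chamber `chamber σ η₀`. -/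
theorem differentiableAt_hsEntropy (hFa : AnalyticOnNhd ℝ F (Ioo (-η₀) η₀))
    (hF : EqOn hsExcessFreeEnergy F (Ico 0 η₀)) {σ : ℝ} (hσ : 0 < σ) {U : State}
    (hU : U ∈ chamber σ η₀) : DifferentiableAt ℝ (hsEntropy σ) U :=
  ((contDiffOn_hsEntropy hFa hF hσ le_rfl).differentiableOn (by simp)).differentiableAt
    ((isOpen_chamber σ η₀).mem_nhds hU)

/-- Differentiability of the fluxes at a point of the chamber `chamber σ η₀`. -/
theorem differentiableAt_eulerFlux (hFa : AnalyticOnNhd ℝ F (Ioo (-η₀) η₀))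
    (hF : EqOn hsExcessFreeEnergy F (Ico 0 η₀)) {σ : ℝ} (hσ : 0 < σ) {U : State}
    (hU : U ∈ chamber σ η₀) (j : Fin 3) : DifferentiableAt ℝ (eulerFlux σ j) U :=
  ((contDiffOn_eulerFlux hFa hF hσ le_rfl j).differentiableOn (by simp)).differentiableAt
    ((isOpen_chamber σ η₀).mem_nhds hU)

/-! ## The gradient of the entropy (the entropy variables) -/

/-- The derivative of the entropy along the line `t ↦ stateOf ρ u θ + t • V` at `t = 0`:
`Dη_σ(U) V = λ⁰ V.ρ + ⟪u/θ, V.m⟫ − V.E/θ`,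
`λ⁰ = log ρ + f_ex(ρσ³) + ρσ³ f_ex′(ρσ³) − (3/2) log θ − |u|²/(2θ) + 5/2`. -/
theorem hasDerivAt_hsEntropy_line (hFa : AnalyticOnNhd ℝ F (Ioo (-η₀) η₀))
    (hF : EqOn hsExcessFreeEnergy F (Ico 0 η₀)) {σ ρ θ : ℝ} (u : V3) (hσ : 0 < σ) (hρ : 0 < ρ)
    (hθ : 0 < θ) (hx : ρ * σ ^ 3 < η₀) (V : State) :
    HasDerivAt (fun t : ℝ => hsEntropy σ (stateOf ρ u θ + t • V))
      ((Real.log ρ + hsExcessFreeEnergy (ρ * σ ^ 3) +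
          ρ * σ ^ 3 * deriv hsExcessFreeEnergy (ρ * σ ^ 3) -
          3 / 2 * Real.log θ - ‖u‖ ^ 2 / (2 * θ) + 5 / 2) * V.1 +
        inner ℝ (θ⁻¹ • u) V.2.1 - θ⁻¹ * V.2.2) 0 := by
  set a : ℝ → ℝ := fun t => ρ + t * V.1 with ha_def
  set q : ℝ → ℝ := fun t => ‖ρ • u + t • V.2.1‖ ^ 2 with hq_def
  set e : ℝ → ℝ := fun t => ρ * (‖u‖ ^ 2 / 2 + 3 / 2 * θ) + t * V.2.2 with he_def
  have hfun : (fun t : ℝ => hsEntropy σ (stateOf ρ u θ + t • V)) = fun t =>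
      -(a t * (3 / 2 * Real.log (2 / 3 * (e t / a t - q t / (2 * a t ^ 2))) - Real.log (a t) -
        hsExcessFreeEnergy (a t * σ ^ 3))) := by
    funext t
    simp [hsEntropy, stateOf, totalEnergyDensity, a, q, e]
  rw [hfun]
  have ha : HasDerivAt a V.1 0 := by
    simpa [a] using ((hasDerivAt_id (0 : ℝ)).mul_const V.1).const_add ρ
  have hq : HasDerivAt q (2 * inner ℝ (ρ • u) V.2.1) 0 := by
    have hl : HasDerivAt (fun s : ℝ => ρ • u + s • V.2.1) V.2.1 0 := by
      simpa using ((hasDerivAt_id (0 : ℝ)).smul_const V.2.1).const_add (ρ • u)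
    simpa [q] using hl.norm_sq
  have he : HasDerivAt e V.2.2 0 := by
    simpa [e] using ((hasDerivAt_id (0 : ℝ)).mul_const V.2.2).const_add
      (ρ * (‖u‖ ^ 2 / 2 + 3 / 2 * θ))
  have ha0 : a 0 = ρ := by simp [a]
  have hq0 : q 0 = ρ ^ 2 * ‖u‖ ^ 2 := by
    simp [q, norm_smul, mul_pow]
  have he0 : e 0 = ρ * (‖u‖ ^ 2 / 2 + 3 / 2 * θ) := by simp [e]
  have hρ0 : a 0 ≠ 0 := by rw [ha0]; exact hρ.ne'
  have h2a : 2 * a 0 ^ 2 ≠ 0 := by rw [ha0]; positivity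
  have hw0 : e 0 / a 0 - q 0 / (2 * a 0 ^ 2) = 3 / 2 * θ := by
    rw [ha0, hq0, he0]
    field_simp
    ring
  have hw0' : 2 / 3 * (e 0 / a 0 - q 0 / (2 * a 0 ^ 2)) ≠ 0 := by
    rw [hw0]; positivity
  have hw : HasDerivAt (fun t => e t / a t - q t / (2 * a t ^ 2))
      ((V.2.2 * a 0 - e 0 * V.1) / a 0 ^ 2 -
        (2 * inner ℝ (ρ • u) V.2.1 * (2 * a 0 ^ 2) - q 0 * (2 * (2 * a 0 ^ 1 * V.1))) /
          (2 * a 0 ^ 2) ^ 2) 0 :=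
    (he.div ha hρ0).sub (hq.div ((ha.pow 2).const_mul 2) h2a)
  have hlogw := ((hw.const_mul (2 / 3)).log hw0')
  have hloga := ha.log hρ0
  have hxmem : ρ * σ ^ 3 ∈ Ioo 0 η₀ := ⟨by positivity, hx⟩
  have hf : HasDerivAt (fun t => hsExcessFreeEnergy (a t * σ ^ 3))
      (deriv hsExcessFreeEnergy (ρ * σ ^ 3) * (V.1 * σ ^ 3)) 0 :=
    (hasDerivAt_hsExcessFreeEnergy hFa hF hxmem).comp_of_eq 0 (ha.mul_const (σ ^ 3))
      (by rw [ha0])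
  have hall := (ha.fun_mul (((hlogw.const_mul (3 / 2)).fun_sub hloga).fun_sub hf)).fun_neg
  refine hall.congr_deriv ?_
  simp only [ha0, hq0, he0] at hw0 ⊢
  rw [hw0, show (2 : ℝ) / 3 * (3 / 2 * θ) = θ by ring, real_inner_smul_left, real_inner_smul_left]
  field_simp
  ring

/-- **The entropy variables.** At `U = stateOf ρ u θ` in the chamber (`ρ, θ > 0`, `ρσ³ < η₀`),
`Dη_σ(U) V = λ⁰ V.1 + ⟪θ⁻¹ u, V.2.1⟫ − θ⁻¹ V.2.2` with
`λ⁰ = log ρ + f_ex(ρσ³) + ρσ³ f_ex′(ρσ³) − (3/2) log θ − |u|²/(2θ) + 5/2`. -/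
theorem fderiv_hsEntropy_apply (hFa : AnalyticOnNhd ℝ F (Ioo (-η₀) η₀))
    (hF : EqOn hsExcessFreeEnergy F (Ico 0 η₀)) {σ ρ θ : ℝ} (u : V3) (hσ : 0 < σ) (hρ : 0 < ρ)
    (hθ : 0 < θ) (hx : ρ * σ ^ 3 < η₀) (V : State) :
    fderiv ℝ (hsEntropy σ) (stateOf ρ u θ) V =
      (Real.log ρ + hsExcessFreeEnergy (ρ * σ ^ 3) + ρ * σ ^ 3 * deriv hsExcessFreeEnergy (ρ * σ ^ 3) -
          3 / 2 * Real.log θ - ‖u‖ ^ 2 / (2 * θ) + 5 / 2) * V.1 +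
        inner ℝ (θ⁻¹ • u) V.2.1 - θ⁻¹ * V.2.2 := by
  have hd : DifferentiableAt ℝ (hsEntropy σ) (stateOf ρ u θ) :=
    differentiableAt_hsEntropy hFa hF hσ (stateOf_mem_chamber u hρ hθ hx)
  have hline : HasDerivAt (fun t : ℝ => stateOf ρ u θ + t • V) V 0 := by
    simpa using ((hasDerivAt_id (0 : ℝ)).smul_const V).const_add (stateOf ρ u θ)
  have h1 : HasDerivAt (fun t : ℝ => hsEntropy σ (stateOf ρ u θ + t • V))
      (fderiv ℝ (hsEntropy σ) (stateOf ρ u θ) V) 0 :=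
    hd.hasFDerivAt.comp_hasDerivAt_of_eq 0 hline (by simp)
  exact h1.unique (hasDerivAt_hsEntropy_line hFa hF u hσ hρ hθ hx V)

/-- **The relative entropy in primitive variables.** For `U = stateOf ρ u θ` in the chamber and
`V = stateOf r v s`, `r ≠ 0`: `h_σ(V | U)` is the sum of the density part `r log(r/ρ) − r + ρ`, the
thermal part `(3/2) r (s/θ − 1 − log(s/θ))`, the kinetic part `r |v − u|²/(2θ)` and the Bregman
divergence of the excess part `r ↦ r f_ex(rσ³)`. -/
theorem relEnt_stateOf (hFa : AnalyticOnNhd ℝ F (Ioo (-η₀) η₀))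
    (hF : EqOn hsExcessFreeEnergy F (Ico 0 η₀)) {σ ρ θ : ℝ} (u : V3) (hσ : 0 < σ) (hρ : 0 < ρ)
    (hθ : 0 < θ) (hx : ρ * σ ^ 3 < η₀) {r : ℝ} (hr : r ≠ 0) (v : V3) (s : ℝ) :
    relEnt σ (stateOf r v s) (stateOf ρ u θ) =
      (r * Real.log r - r * Real.log ρ - r + ρ) +
      3 / 2 * r * (s / θ - 1 - (Real.log s - Real.log θ)) +
      r * ‖v - u‖ ^ 2 / (2 * θ) +
      (r * hsExcessFreeEnergy (r * σ ^ 3) - ρ * hsExcessFreeEnergy (ρ * σ ^ 3) -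
        (hsExcessFreeEnergy (ρ * σ ^ 3) + ρ * σ ^ 3 * deriv hsExcessFreeEnergy (ρ * σ ^ 3)) *
          (r - ρ)) := by
  unfold relEnt
  rw [fderiv_hsEntropy_apply hFa hF u hσ hρ hθ hx, hsEntropy_stateOf σ hr, hsEntropy_stateOf σ hρ.ne']
  simp only [Prod.fst_sub, Prod.snd_sub, stateOf_fst, stateOf_snd_fst, stateOf_snd_snd]
  simp only [inner_sub_right, real_inner_smul_left, real_inner_smul_right,
    real_inner_self_eq_norm_sq]
  rw [norm_sub_sq_real, real_inner_comm u v]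
  field_simp
  ring

end Barycentric

end Summit.AtomisticToContinuum.HydrodynamicLimit.Theorems.MacroClosureLine

end
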